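/-
Copyright (c) 2026. All rights reserved.
Released under Apache 2.0 license as described in the file LICENSE.
Authors: HodgeCM publication cell (pub-hodgecm), DAG-node prover lineages #07 (gen 2: statements and proofs)
and #13 (gen 7: tree port).
-/
import Mathlib.MeasureTheory.Measure.Haar.DistribChar
import Mathlib.MeasureTheory.Function.L2Space
import Mathlib.Analysis.Complex.Circle
import Mathlib.Analysis.SpecialFunctions.Pow.NNReal

/-!
# The unitary dilation representation on `L²(X, μ)`: `(ω(g) f)(x) = ν(g) δ(g)^{1/2} f(g • x)`

Topic `RepresentationTheory/HeisenbergGroup`; namespace `Literature.RepresentationTheory.HeisenbergGroup.DilationModel`.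
Let a commutative group `G` act distributively and by homeomorphisms on a locally compact abelian group `X`
carrying an additive Haar measure `μ`, and let `δ = distribHaarChar X : G →* ℝ≥0` be Mathlib's modulus of the
action (`μ (g • s) = δ(g) μ s`).  For a unitary character `ν : G →* S¹` the operators
`(ω(g) f)(x) = ν(g) δ(g)^{1/2} f(g • x)` are UNITARY on `L²(X, μ)` and `g ↦ ω(g)` is a homomorphism
`dilationRep μ ν : G →* (Lp ℂ 2 μ ≃ₗᵢ[ℂ] Lp ℂ 2 μ)`.

This is the action of the Levi factor `GL(X)` of the Siegel parabolic of a complete polarisation `W = X + X*` in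
the Schrödinger model of the Weil (metaplectic) representation: C. Mœglin, M.-F. Vignéras, J.-L. Waldspurger,
*Correspondances de Howe sur un corps p-adique*, LNM 1291 (1987) [MoeglinVignerasWaldspurger1987], Chap. 2, II.6
(held text `book:moeglinnd-correspondances-de-howe-sur-un-corps-p`, chunk p0041 L14): for `a ∈ GL(X)` and
`g = diag(a, a*⁻¹)`, "`M[g]f(x*) = |det_X a|^{1/2} f(a* x*)`" — here `|det_X a| = δ(a)` and the square root is what
makes the operator isometric on `L²`; the character `ν` records MVW's "à un caractère près" (II.1 (A), p0035:
"`M` est unique à un scalaire près").  For `G = Fˣ` acting on `X = Fⁿ` over a local field this is the familiar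
`φ ↦ ν(y) |y|^{n/2} φ(y ·)` (A. Weil, Acta Math. 111 (1964) [Weil1964], Chap. I).

WHAT IS REPRODUCED (kernel proofs from Mathlib only):
* §1 change of variables `map_smul_eq : μ.map (g • ·) = δ(g)⁻¹ • μ`, the weight `weight X ν g = ν(g) δ(g)^{1/2}` and
  its multiplicativity, `eLpNorm_comp_smul : ‖f ∘ (g • ·)‖₂ = δ(g)^{-1/2} ‖f‖₂`;
* §2 the unitary operator `dilate μ ν g : Lp ℂ 2 μ ≃ₗᵢ[ℂ] Lp ℂ 2 μ` and the representation `dilationRep μ ν`;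
* §3 the matrix coefficient at an indicator: `⟪𝟙_A, ω(g) 𝟙_A⟫ = ν(g) δ(g)^{1/2} μ(A ∩ g⁻¹A)`
  (`inner_indicator_dilationRep`).

Design: unbundled Mathlib classes (`DistribMulAction G X`, `ContinuousConstSMul G X`, `IsAddHaarMeasure μ`,
`μ.Regular`), so the results apply verbatim to `Fˣ` (or a torus) acting on `Fⁿ` for a local field `F`, and to
`ℝˣ` on `ℝⁿ`.  NOT here: the translations / modulations of the Schrödinger system and the rigidity of the Levi
action (`SchrodingerSystem.lean`, `LeviRigidity.lean` in this directory), smooth vectors, the full Weil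
representation.

Provenance: tree port (LEAN-IN-TREE, 2026-08-18) of §1 `General` of the HodgeCM publication cell's package file
`HodgeCM/PerL34/LocalFactors/DilationModel.lean` (unit `pub-hodgecm-pv07-g2`, gate run 24; statements and proofs
verbatim, namespace `HodgeCM.PerL34.LocalFactors.DilationModel` ↦
`Literature.RepresentationTheory.HeisenbergGroup.DilationModel`), where it is the split local factor
`(ω(y)φ)(x) = |y|^{3/2} φ(yx)` of a theta integral; the package's §2 (a specific problem-side instance) is not ported.
-/

set_option autoImplicit false

noncomputable section

open MeasureTheory MeasureTheory.Measure Set Complex ComplexConjugate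
open scoped ENNReal NNReal Pointwise InnerProductSpace

namespace Literature.RepresentationTheory.HeisenbergGroup.DilationModel

variable {G : Type*} [CommGroup G] {X : Type*} [AddCommGroup X] [DistribMulAction G X]
  [TopologicalSpace X] [IsTopologicalAddGroup X] [LocallyCompactSpace X] [ContinuousConstSMul G X]
  [MeasurableSpace X] [BorelSpace X] (μ : Measure X) [μ.IsAddHaarMeasure] [μ.Regular]

/-! ## §1 Change of variables under `x ↦ g • x` and the weight `ν(g) δ(g)^{1/2}` -/

/-- change of variables: pushing `μ` along `x ↦ g • x` divides it by the modulus, `μ ∘ (g•)⁻¹ = δ(g)⁻¹ • μ`.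
[folklore] -/
theorem map_smul_eq (g : G) : μ.map (fun x : X => g • x) = ((distribHaarChar X g)⁻¹ : ℝ≥0) • μ := by
  ext s hs
  rw [Measure.map_apply (measurable_const_smul g) hs, Set.preimage_smul, Measure.coe_nnreal_smul_apply,
    ← map_inv, distribHaarChar_mul μ g⁻¹ s]

/-- `μ((g•)⁻¹ s) = δ(g)⁻¹ μ(s)`. [folklore] -/
theorem measure_preimage_smul_eq (g : G) (s : Set X) :
    μ ((fun x : X => g • x) ⁻¹' s) = (distribHaarChar X g)⁻¹ * μ s := by
  rw [Set.preimage_smul, ← map_inv, distribHaarChar_mul μ g⁻¹ s]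

/-- the preimage `(g•)⁻¹ s` of a set of finite measure has finite measure. [folklore] -/
theorem measure_preimage_smul_ne_top (g : G) {s : Set X} (hs : μ s ≠ ⊤) :
    μ ((fun x : X => g • x) ⁻¹' s) ≠ ⊤ := by
  rw [measure_preimage_smul_eq]; exact ENNReal.mul_ne_top ENNReal.coe_ne_top hs

/-- `x ↦ g • x` is quasi-measure-preserving for an additive Haar measure. [folklore] -/
theorem quasiMeasurePreserving_smul' (g : G) : QuasiMeasurePreserving (fun x : X => g • x) μ μ := by
  refine ⟨measurable_const_smul g, ?_⟩
  rw [map_smul_eq μ g]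
  exact Measure.smul_absolutelyContinuous

variable (X) in
/-- the weight `ν(g) · δ(g)^{1/2}` of the dilation operator, `δ = distribHaarChar X` — MVW's `|det_X a|^{1/2}`
times a unitary character (the half-modulus twist making the Koopman operator unitary). [folklore] -/
def weight (ν : G →* Circle) (g : G) : ℂ := (ν g : ℂ) * ((NNReal.sqrt (distribHaarChar X g) : ℝ) : ℂ)

omit [MeasurableSpace X] [BorelSpace X] in
/-- `‖ν(g) δ(g)^{1/2}‖ = δ(g)^{1/2}`. [folklore] -/
theorem nnnorm_weight (ν : G →* Circle) (g : G) : ‖weight X ν g‖₊ = NNReal.sqrt (distribHaarChar X g) := by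
  rw [weight, nnnorm_mul, ← norm_toNNReal, Circle.norm_coe, Real.toNNReal_one, one_mul,
    Complex.nnnorm_real, NNReal.nnnorm_eq]

omit [MeasurableSpace X] [BorelSpace X] in
/-- the weight is multiplicative in `g`. [folklore] -/
theorem weight_mul (ν : G →* Circle) (g h : G) : weight X ν (g * h) = weight X ν g * weight X ν h := by
  simp only [weight, map_mul, Circle.coe_mul, NNReal.sqrt_mul, NNReal.coe_mul, Complex.ofReal_mul]
  ring

omit [MeasurableSpace X] [BorelSpace X] in
/-- the weight of `1` is `1`. [folklore] -/
theorem weight_one (ν : G →* Circle) : weight X ν 1 = 1 := by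
  simp [weight]

omit [MeasurableSpace X] [BorelSpace X] in
/-- `weight(g⁻¹) · weight(g) = 1`. [folklore] -/
theorem weight_inv_mul_self (ν : G →* Circle) (g : G) : weight X ν g⁻¹ * weight X ν g = 1 := by
  rw [← weight_mul, inv_mul_cancel, weight_one]

/-- square-integrability is preserved by `f ↦ f ∘ (g • ·)`. [folklore] -/
theorem memLp_comp_smul {f : X → ℂ} (hf : MemLp f 2 μ) (g : G) : MemLp (fun x => f (g • x)) 2 μ := by
  have h1 : MemLp f 2 (μ.map (fun x : X => g • x)) := by
    rw [map_smul_eq μ g]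
    exact hf.smul_measure ENNReal.coe_ne_top
  exact h1.comp_of_map (measurable_const_smul g).aemeasurable

/-- `‖f ∘ (g•)‖₂ = δ(g)^{-1/2} ‖f‖₂`. [folklore] -/
theorem eLpNorm_comp_smul (f : X → ℂ) (hf : AEStronglyMeasurable f μ) (g : G) :
    eLpNorm (fun x => f (g • x)) 2 μ
      = (((distribHaarChar X g)⁻¹ ^ (2⁻¹ : ℝ) : ℝ≥0) : ℝ≥0∞) * eLpNorm f 2 μ := by
  have hf' : AEStronglyMeasurable f (μ.map (fun x : X => g • x)) := by
    rw [map_smul_eq μ g]; exact hf.smul_measure _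
  have := eLpNorm_map_measure (p := 2) hf' (measurable_const_smul g).aemeasurable
  rw [show (f ∘ fun x : X => g • x) = fun x => f (g • x) from rfl] at this
  rw [← this, map_smul_eq μ g, eLpNorm_smul_measure_of_ne_zero' (inv_ne_zero distribHaarChar_pos.ne')]
  simp [ENNReal.smul_def]

/-! ## §2 The dilation operator and the dilation representation -/

/-- the dilated function `x ↦ ν(g) δ(g)^{1/2} f(g • x)` of an `L²` class, as an `L²` class. [folklore] -/
def dilateFun (ν : G →* Circle) (g : G) (f : Lp ℂ 2 μ) : Lp ℂ 2 μ :=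
  ((memLp_comp_smul μ (Lp.memLp f) g).const_smul (weight X ν g)).toLp _

/-- `dilateFun μ ν g f = ν(g) δ(g)^{1/2} f(g • ·)` almost everywhere. [folklore] -/
theorem coeFn_dilateFun (ν : G →* Circle) (g : G) (f : Lp ℂ 2 μ) :
    ⇑(dilateFun μ ν g f) =ᵐ[μ] fun x => weight X ν g * f (g • x) :=
  MemLp.coeFn_toLp _

/-- the dilation operator preserves the `L²` norm (this is where `δ^{1/2}` is used). [folklore] -/
theorem eLpNorm_dilateFun (ν : G →* Circle) (g : G) (f : Lp ℂ 2 μ) :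
    eLpNorm (dilateFun μ ν g f) 2 μ = eLpNorm f 2 μ := by
  have key : NNReal.sqrt (distribHaarChar X g) * (distribHaarChar X g)⁻¹ ^ (2⁻¹ : ℝ) = 1 := by
    rw [NNReal.sqrt_eq_rpow, one_div, ← NNReal.mul_rpow, mul_inv_cancel₀ distribHaarChar_pos.ne',
      NNReal.one_rpow]
  rw [eLpNorm_congr_ae (coeFn_dilateFun μ ν g f)]
  rw [show (fun x => weight X ν g * f (g • x)) = weight X ν g • fun x => f (g • x) from rfl,
    eLpNorm_const_smul, eLpNorm_comp_smul μ f (Lp.aestronglyMeasurable f) g, ← mul_assoc,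
    enorm_eq_nnnorm, nnnorm_weight, ← ENNReal.coe_mul, key, ENNReal.coe_one, one_mul]

/-- `‖dilateFun μ ν g f‖ = ‖f‖`. [folklore] -/
theorem norm_dilateFun (ν : G →* Circle) (g : G) (f : Lp ℂ 2 μ) : ‖dilateFun μ ν g f‖ = ‖f‖ := by
  rw [Lp.norm_def, Lp.norm_def, eLpNorm_dilateFun]

/-- additivity of `dilateFun μ ν g`. [folklore] -/
theorem dilateFun_add (ν : G →* Circle) (g : G) (f f' : Lp ℂ 2 μ) :
    dilateFun μ ν g (f + f') = dilateFun μ ν g f + dilateFun μ ν g f' := by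
  apply Lp.ext
  refine (coeFn_dilateFun μ ν g _).trans (Filter.EventuallyEq.trans ?_ (Lp.coeFn_add _ _).symm)
  have h := (quasiMeasurePreserving_smul' μ g).ae_eq_comp (Lp.coeFn_add f f')
  filter_upwards [h, coeFn_dilateFun μ ν g f, coeFn_dilateFun μ ν g f'] with x hx h1 h2
  simp only [Function.comp_apply, Pi.add_apply] at hx
  simp only [Pi.add_apply, h1, h2, hx, mul_add]

/-- homogeneity of `dilateFun μ ν g`. [folklore] -/
theorem dilateFun_smul (ν : G →* Circle) (g : G) (c : ℂ) (f : Lp ℂ 2 μ) :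
    dilateFun μ ν g (c • f) = c • dilateFun μ ν g f := by
  apply Lp.ext
  refine (coeFn_dilateFun μ ν g _).trans (Filter.EventuallyEq.trans ?_ (Lp.coeFn_smul _ _).symm)
  have h := (quasiMeasurePreserving_smul' μ g).ae_eq_comp (Lp.coeFn_smul c f)
  filter_upwards [h, coeFn_dilateFun μ ν g f] with x hx h1
  simp only [Function.comp_apply, Pi.smul_apply, smul_eq_mul] at hx
  simp only [Pi.smul_apply, h1, hx, smul_eq_mul]
  ring

/-- the cocycle law `dilateFun (g * h) = dilateFun g ∘ dilateFun h`. [folklore] -/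
theorem dilateFun_mul (ν : G →* Circle) (g h : G) (f : Lp ℂ 2 μ) :
    dilateFun μ ν (g * h) f = dilateFun μ ν g (dilateFun μ ν h f) := by
  apply Lp.ext
  refine (coeFn_dilateFun μ ν _ _).trans (Filter.EventuallyEq.trans ?_ (coeFn_dilateFun μ ν g _).symm)
  have hh := (quasiMeasurePreserving_smul' μ g).ae_eq_comp (coeFn_dilateFun μ ν h f)
  filter_upwards [hh] with x hx
  simp only [Function.comp_apply] at hx
  rw [hx, weight_mul, mul_comm g h, mul_smul, mul_assoc]

/-- `dilateFun 1 = id`. [folklore] -/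
theorem dilateFun_one (ν : G →* Circle) (f : Lp ℂ 2 μ) : dilateFun μ ν 1 f = f := by
  apply Lp.ext
  refine (coeFn_dilateFun μ ν _ _).trans ?_
  filter_upwards [] with x
  rw [weight_one, one_smul, one_mul]

/-- `dilateFun g⁻¹` is a left inverse of `dilateFun g`. [folklore] -/
theorem dilateFun_inv_apply (ν : G →* Circle) (g : G) (f : Lp ℂ 2 μ) :
    dilateFun μ ν g⁻¹ (dilateFun μ ν g f) = f := by
  rw [← dilateFun_mul, inv_mul_cancel, dilateFun_one]

/-- **The dilation operator** `ω(g) : f ↦ ν(g) δ(g)^{1/2} f(g • ·)`, a unitary operator on `L²(X, μ)` — the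
Levi action `M[diag(a, a*⁻¹)] f = |det_X a|^{1/2} f ∘ a*` of the Schrödinger model.
[cite: MoeglinVignerasWaldspurger1987, Chap. 2 II.6] -/
def dilate (ν : G →* Circle) (g : G) : Lp ℂ 2 μ ≃ₗᵢ[ℂ] Lp ℂ 2 μ where
  toFun := dilateFun μ ν g
  map_add' := dilateFun_add μ ν g
  map_smul' := dilateFun_smul μ ν g
  invFun := dilateFun μ ν g⁻¹
  left_inv := dilateFun_inv_apply μ ν g
  right_inv f := by simpa only [inv_inv] using dilateFun_inv_apply μ ν g⁻¹ f
  norm_map' := norm_dilateFun μ ν g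

/-- `dilate μ ν g f = dilateFun μ ν g f`. [folklore] -/
@[simp] theorem dilate_apply (ν : G →* Circle) (g : G) (f : Lp ℂ 2 μ) :
    dilate μ ν g f = dilateFun μ ν g f := rfl

/-- **The dilation representation** `ω : G →* U(L²(X, μ))`, `(ω(g) f)(x) = ν(g) δ(g)^{1/2} f(g • x)`.
[cite: MoeglinVignerasWaldspurger1987, Chap. 2 II.6] -/
def dilationRep (ν : G →* Circle) : G →* (Lp ℂ 2 μ ≃ₗᵢ[ℂ] Lp ℂ 2 μ) where
  toFun := dilate μ ν
  map_one' := LinearIsometryEquiv.ext fun f => by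
    rw [dilate_apply, dilateFun_one, LinearIsometryEquiv.one_def]; rfl
  map_mul' g h := LinearIsometryEquiv.ext fun f => by
    rw [LinearIsometryEquiv.coe_mul, Function.comp_apply, dilate_apply, dilate_apply, dilate_apply,
      dilateFun_mul]

/-- `(ω(g) f)(x) = ν(g) δ(g)^{1/2} f(g • x)` almost everywhere. [folklore] -/
theorem coeFn_dilationRep (ν : G →* Circle) (g : G) (f : Lp ℂ 2 μ) :
    ⇑(dilationRep μ ν g f) =ᵐ[μ] fun x => weight X ν g * f (g • x) :=
  coeFn_dilateFun μ ν g f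

/-! ## §3 Matrix coefficients at indicator vectors -/

/-- `ω(g) 𝟙_A = ν(g) δ(g)^{1/2} 𝟙_{g⁻¹ A}`. [folklore] -/
theorem dilationRep_indicatorConstLp (ν : G →* Circle) (g : G) {A : Set X} (hA : MeasurableSet A)
    (hμA : μ A ≠ ⊤) :
    dilationRep μ ν g (indicatorConstLp 2 hA hμA (1 : ℂ))
      = weight X ν g • indicatorConstLp 2 (hA.preimage (measurable_const_smul g))
          (measure_preimage_smul_ne_top μ g hμA) (1 : ℂ) := by
  apply Lp.ext
  refine (coeFn_dilationRep μ ν g _).trans (Filter.EventuallyEq.trans ?_ (Lp.coeFn_smul _ _).symm)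
  have h := (quasiMeasurePreserving_smul' μ g).ae_eq_comp
    (indicatorConstLp_coeFn (p := 2) (hs := hA) (hμs := hμA) (c := (1 : ℂ)))
  filter_upwards [h, indicatorConstLp_coeFn (p := 2) (μ := μ)
    (hs := hA.preimage (measurable_const_smul g))
    (hμs := measure_preimage_smul_ne_top μ g hμA) (c := (1 : ℂ))] with x hx h2
  simp only [Function.comp_apply] at hx
  rw [hx, Pi.smul_apply, h2, smul_eq_mul]
  rfl

/-- **Matrix coefficient of the dilation representation at an indicator**:
`⟪𝟙_A, ω(g) 𝟙_A⟫ = ν(g) δ(g)^{1/2} · μ(A ∩ g⁻¹A)`. [folklore] -/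
theorem inner_indicator_dilationRep (ν : G →* Circle) (g : G) {A : Set X} (hA : MeasurableSet A)
    (hμA : μ A ≠ ⊤) :
    ⟪indicatorConstLp 2 hA hμA (1 : ℂ), dilationRep μ ν g (indicatorConstLp 2 hA hμA (1 : ℂ))⟫_ℂ
      = weight X ν g * (μ.real (A ∩ (fun x => g • x) ⁻¹' A) : ℂ) := by
  rw [dilationRep_indicatorConstLp, inner_smul_right,
    L2.inner_indicatorConstLp_one_indicatorConstLp_one hA _ hμA (measure_preimage_smul_ne_top μ g hμA)]
  rfl

end Literature.RepresentationTheory.HeisenbergGroup.DilationModel
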